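import Summits.AnomalousDissipation.AnomalousDissipation.Theorems.SoloBlindShearDesign

/-!
# Laminar states of a lacunary shear design: existence, energy, enstrophy (solo soloist, blind mode)

Continuation of `SoloBlindShearDesign`. For a shear design `D` (force `f = f₁(x₂,x₃) e₁` with
lacunary Fourier support `±K n`, amplitudes `a n`), a momentum vector `M ∈ ℝ³` and `ν > 0`, the
field `u = M + Re ∑ₖ σ_ν(k)⁻¹ F(k) e_k` (`σ_ν` = `shearSymbol`, `F` = `ShearDesign.forceCoeff`)
is an EXACT classical steady state of `NS_ν(f)`: its self-advection vanishes on the Fourier side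
(`transportSym_stateCoeff` — a shear profile independent of `x₁` does not transport itself), so
the steady lattice system is diagonal (`lattice_eq`) and the tree's
`SteadyLatticeDrift.steadyState_of_fourier_drift` produces the state (`exists_shearState`).

Quantitative content, uniform in the viscosity:
* `integral_norm_sq_le_of_coeff`: `∫‖u‖² ≤ ‖M‖² + 2 ∑ₙ aₙ² / (2π Kₙ·M)²` whenever no mode is
  resonant (`Kₙ·M ≠ 0`) — from `|σ_ν(k)| ≥ 2π |k·M|`;
* `dissipation_ge_of_coeff`: `4π² ∑_{n<N} |Kₙ|² aₙ² / |σ_ν(Kₙ)|² ≤ ‖∇u‖₂²` for every `N`;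
* `exists_shearFamily`: along ANY positive viscosity sequence the laminar states are global
  Leray–Hopf solutions for the FIXED force of the design, with the two bounds above and mean
  mode `M`.
The small-divisor application (bounded energy, unbounded enstrophy) is `SoloBlindSmallDivisorRung`.
[cite: DoeringFoias2002, §2]
-/

open MeasureTheory Filter Topology Set UnitAddTorus Function
open scoped ENNReal NNReal ComplexConjugate InnerProductSpace

noncomputable section

namespace Summit.AnomalousDissipation.AnomalousDissipation.Theorems

open Literature.Analysis.FunctionSpaces Literature.Analysis.FunctionSpaces.Torus
open Literature.Analysis.FunctionSpaces.EuclideanSpace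
open Literature.Analysis.FluidPDE Literature.Analysis.FluidPDE.ScalarFourier
open Literature.Analysis.FluidPDE.SteadyLattice Literature.Analysis.FluidPDE.SteadyLatticeDrift

/-- The physical flat unit torus `T³` (local notation). -/
local notation "𝕋³" => UnitAddTorus (Fin 3)
/-- Velocity values on `T³` (local notation). -/
local notation "E³" => EuclideanSpace ℝ (Fin 3)
/-- Complex coefficient vectors (local notation). -/
local notation "ℂ³" => EuclideanSpace ℂ (Fin 3)

namespace ShearDesign

variable (D : ShearDesign)

/-! ### The laminar state on the Fourier side -/

/-- The Fourier coefficients `b(k) = σ_ν(k)⁻¹ F(k)` of the fluctuation of the laminar state. [folklore] -/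
def stateCoeff (ν : ℝ) (M : E³) : (Fin 3 → ℤ) → ℂ³ := fun k => (shearSymbol ν M k)⁻¹ • D.forceCoeff k

/-- Coordinates of `b(k)`. -/
theorem stateCoeff_apply (ν : ℝ) (M : E³) (k : Fin 3 → ℤ) (j : Fin 3) :
    D.stateCoeff ν M k j = if j = 0 then (shearSymbol ν M k)⁻¹ * ((D.amp k : ℝ) : ℂ) else 0 := by
  rw [stateCoeff, PiLp.smul_apply, forceCoeff_apply, smul_eq_mul, mul_ite, mul_zero]

/-- `b(0) = 0`. -/
theorem stateCoeff_zero (ν : ℝ) (M : E³) : D.stateCoeff ν M 0 = 0 := by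
  rw [stateCoeff, forceCoeff_zero, smul_zero]

/-- `‖b(k)‖ = |φ(k)| / |σ_ν(k)|`. -/
theorem norm_stateCoeff (ν : ℝ) (M : E³) (k : Fin 3 → ℤ) :
    ‖D.stateCoeff ν M k‖ = |D.amp k| / ‖shearSymbol ν M k‖ := by
  rw [stateCoeff, norm_smul, norm_inv, norm_forceCoeff, div_eq_inv_mul]

/-- The state coefficients decay rapidly (`|σ_ν(k)| ≥ 4π²ν`). [folklore] -/
theorem rapidDecay_stateCoeff {ν : ℝ} (hν : 0 < ν) (M : E³) : RapidDecay (D.stateCoeff ν M) := by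
  refine D.rapidDecay_forceCoeff.of_norm_le_mul (C := (ν * (4 * Real.pi ^ 2))⁻¹) fun k => ?_
  by_cases hk : k = 0
  · subst hk; simp [stateCoeff_zero, forceCoeff_zero]
  · rw [stateCoeff, norm_smul, norm_inv]
    have hpos : 0 < ν * (4 * Real.pi ^ 2) := by positivity
    exact mul_le_mul_of_nonneg_right
      ((inv_le_inv₀ (hpos.trans_le (norm_shearSymbol_ge hν.le M hk)) hpos).2
        (norm_shearSymbol_ge hν.le M hk)) (norm_nonneg _)

/-- The state coefficients are conjugate symmetric (the state is real). [folklore] -/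
theorem isConjSymm_stateCoeff (ν : ℝ) (M : E³) : IsConjSymm (D.stateCoeff ν M) := fun k => by
  rw [stateCoeff, stateCoeff, shearSymbol_neg, conjVec_smul, map_inv₀, D.isConjSymm_forceCoeff k]

/-- The state coefficients are transversal. [folklore] -/
theorem stateCoeff_transversal (ν : ℝ) (M : E³) (k : Fin 3 → ℤ) :
    (∑ j : Fin 3, ((k j : ℤ) : ℂ) * D.stateCoeff ν M k j) = 0 := by
  have h : ∀ j : Fin 3, ((k j : ℤ) : ℂ) * D.stateCoeff ν M k j =
      (shearSymbol ν M k)⁻¹ * (((k j : ℤ) : ℂ) * D.forceCoeff k j) := fun j => by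
    rw [stateCoeff, PiLp.smul_apply, smul_eq_mul]; ring
  simp_rw [h]
  rw [← Finset.mul_sum, D.forceCoeff_transversal k, mul_zero]

/-- **The self-transport symbol of a shear state vanishes**: `N(b, b) = 0` — a shear profile
`a(x₂,x₃) e₁` does not advect itself. [folklore] -/
theorem transportSym_stateCoeff (ν : ℝ) (M : E³) (k : Fin 3 → ℤ) (p : Fin 3) :
    transportSym (fun j m => D.stateCoeff ν M m j) (fun m => D.stateCoeff ν M m p) k = 0 := by
  rw [transportSym_apply]
  refine Finset.sum_eq_zero fun j _ => ?_
  rw [lconv_apply]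
  have h : ∀ m : Fin 3 → ℤ,
      D.stateCoeff ν M m j * (dsym j (k - m) * D.stateCoeff ν M (k - m) p) = 0 := by
    intro m
    by_cases hj : j = 0
    · subst hj
      by_cases h0 : (k - m) 0 = 0
      · rw [dsym_apply, h0, Int.cast_zero, mul_zero, zero_mul, mul_zero]
      · rw [D.stateCoeff_apply ν M (k - m) p, D.amp_eq_zero_of_apply_zero_ne h0]
        simp
    · rw [stateCoeff_apply, if_neg hj, zero_mul]
  simp_rw [h]
  exact tsum_zero

/-- **The diagonal lattice identity**: `σ_ν(k) b(k) + Π_k N(b,b)(k) = F(k) = 𝓕 f(k)`. [folklore] -/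
theorem lattice_eq {ν : ℝ} (hν : 0 < ν) (M : E³) (k : Fin 3 → ℤ) :
    (((ν * (4 * Real.pi ^ 2 * freqNormSq k)) : ℝ) : ℂ) • D.stateCoeff ν M k +
      (2 * Real.pi * Complex.I * (∑ jj : Fin 3, ((k jj : ℤ) : ℂ) * complexify M jj)) •
        D.stateCoeff ν M k +
      Torus.lerayCoeff k ((WithLp.toLp 2 (fun pp : Fin 3 =>
        transportSym (fun jj mm => D.stateCoeff ν M mm jj) (fun mm => D.stateCoeff ν M mm pp) k)) :
          ℂ³) = mFourierCoeff (complexify ∘ D.force) k := by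
  have hN : (WithLp.toLp 2 (fun pp : Fin 3 =>
      transportSym (fun jj mm => D.stateCoeff ν M mm jj) (fun mm => D.stateCoeff ν M mm pp) k) : ℂ³)
        = 0 := by
    ext pp; simp [D.transportSym_stateCoeff]
  have hL : Torus.lerayCoeff k (0 : ℂ³) = 0 := by
    unfold Torus.lerayCoeff; split_ifs <;> simp
  rw [hN, hL, add_zero, ← add_smul, sum_intCast_mul_complexify, ← shearSymbol_eq,
    mFourierCoeff_force]
  by_cases hk : k = 0
  · subst hk; rw [stateCoeff_zero, forceCoeff_zero, smul_zero]
  · rw [stateCoeff, smul_smul, mul_inv_cancel₀ (shearSymbol_ne_zero hν M hk), one_smul]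

/-- **The laminar shear state exists**: for `ν > 0` and every momentum `M` there is a classical
steady state `u` of `NS_ν(f)` with `𝓕 u = b + δ₀ M`, i.e. `u = M + Re F_b`. [folklore] -/
theorem exists_shearState {ν : ℝ} (hν : 0 < ν) (M : E³) :
    ∃ (u : 𝕋³ → E³) (p : 𝕋³ → ℝ), Torus.IsSteadyNSState ν D.force u p ∧ IsSmooth u ∧
      mFourierCoeff (complexify ∘ u) =
        D.stateCoeff ν M + (Pi.single (0 : Fin 3 → ℤ) (complexify M) : (Fin 3 → ℤ) → ℂ³) :=
  steadyState_of_fourier_drift D.isSmooth_force D.isDivFree_force D.hasZeroMean_force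
    (D.rapidDecay_stateCoeff hν M) (D.isConjSymm_stateCoeff ν M) (D.stateCoeff_transversal ν M)
    (D.stateCoeff_zero ν M) (conjVec_complexify M) (D.lattice_eq hν M)

/-! ### Energy and enstrophy of the laminar state -/

/-- The ν-independent energy majorant of the mode `n`: `aₙ² / (2π Kₙ·M)²`. -/
def energyMajorant (M : E³) (n : ℕ) : ℝ := D.a n ^ 2 / (2 * Real.pi * kdot (D.K n) M) ^ 2

/-- The energy majorant is nonnegative. -/
theorem energyMajorant_nonneg (M : E³) (n : ℕ) : 0 ≤ D.energyMajorant M n := by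
  unfold energyMajorant; positivity

/-- Per-mode energy bound: `‖b(k)‖² ≤ ext(k)²/(2π k·M)² + ext(-k)²/(2π k·M)²` when no mode is
resonant (`Kₙ·M ≠ 0`). [folklore] -/
theorem norm_sq_stateCoeff_le (ν : ℝ) {M : E³} (hres : ∀ n, kdot (D.K n) M ≠ 0)
    (k : Fin 3 → ℤ) :
    ‖D.stateCoeff ν M k‖ ^ 2 ≤ D.ext k ^ 2 / (2 * Real.pi * kdot k M) ^ 2 +
      D.ext (-k) ^ 2 / (2 * Real.pi * kdot k M) ^ 2 := by
  rw [norm_stateCoeff, div_pow, sq_abs]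
  rcases D.trichotomy k with ⟨n, rfl⟩ | ⟨n, rfl⟩ | ⟨h₁, h₂⟩
  · rw [amp_K, ext_K, ext_negK]
    have hpos : 0 < (2 * Real.pi * kdot (D.K n) M) ^ 2 :=
      sq_pos_of_ne_zero (mul_ne_zero (by positivity) (hres n))
    calc D.a n ^ 2 / ‖shearSymbol ν M (D.K n)‖ ^ 2
        ≤ D.a n ^ 2 / (2 * Real.pi * kdot (D.K n) M) ^ 2 :=
          div_le_div_of_nonneg_left (sq_nonneg _) hpos (sq_kdot_le_norm_sq_shearSymbol ν M _)
      _ ≤ _ := by simp [zero_div]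
  · rw [amp_negK, neg_neg, ext_K, ext_negK, kdot_neg_left]
    have hpos : 0 < (2 * Real.pi * -kdot (D.K n) M) ^ 2 :=
      sq_pos_of_ne_zero (mul_ne_zero (by positivity) (neg_ne_zero.2 (hres n)))
    calc D.a n ^ 2 / ‖shearSymbol ν M (-D.K n)‖ ^ 2
        ≤ D.a n ^ 2 / (2 * Real.pi * -kdot (D.K n) M) ^ 2 :=
          div_le_div_of_nonneg_left (sq_nonneg _) hpos (by
            have := sq_kdot_le_norm_sq_shearSymbol ν M (-D.K n)
            rwa [kdot_neg_left] at this)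
      _ ≤ _ := by simp [zero_div]
  · rw [amp, h₁, h₂, add_zero]
    simp only [ne_eq, OfNat.ofNat_ne_zero, not_false_eq_true, zero_pow, zero_div, add_zero, le_refl]

/-- **Energy of the laminar state, uniformly in `ν`**: if `𝓕 u = b + δ₀ M` then
`∫‖u‖² ≤ ‖M‖² + 2 ∑ₙ aₙ² / (2π Kₙ·M)²`. [folklore] -/
theorem integral_norm_sq_le_of_coeff {ν : ℝ} {M : E³} (hres : ∀ n, kdot (D.K n) M ≠ 0)
    (hA : Summable (D.energyMajorant M)) {u : 𝕋³ → E³} (hu : IsSmooth u)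
    (hû : mFourierCoeff (complexify ∘ u) =
      D.stateCoeff ν M + (Pi.single (0 : Fin 3 → ℤ) (complexify M) : (Fin 3 → ℤ) → ℂ³)) :
    ∫ x, ‖u x‖ ^ 2 ≤ ‖M‖ ^ 2 + 2 * ∑' n, D.energyMajorant M n := by
  have hsum := (hasSum_sq_norm_mFourierCoeff_complexify (hu.memLp 2)).summable
  rw [integral_norm_sq_eq_tsum (hu.memLp 2)]
  rw [hû] at hsum ⊢
  refine hsum.tsum_le_of_sum_le fun T => ?_
  -- the three majorants
  obtain ⟨gM, hgM⟩ : ∃ gM : (Fin 3 → ℤ) → ℝ, gM = fun k =>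
    ‖(Pi.single (0 : Fin 3 → ℤ) (complexify M) : (Fin 3 → ℤ) → ℂ³) k‖ ^ 2 := ⟨_, rfl⟩
  obtain ⟨gp, hgp⟩ : ∃ gp : (Fin 3 → ℤ) → ℝ, gp = fun k =>
    D.ext k ^ 2 / (2 * Real.pi * kdot k M) ^ 2 := ⟨_, rfl⟩
  obtain ⟨gn, hgn⟩ : ∃ gn : (Fin 3 → ℤ) → ℝ, gn = fun k =>
    D.ext (-k) ^ 2 / (2 * Real.pi * kdot k M) ^ 2 := ⟨_, rfl⟩
  have hpt : ∀ k, ‖(D.stateCoeff ν M + (Pi.single (0 : Fin 3 → ℤ) (complexify M) :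
      (Fin 3 → ℤ) → ℂ³)) k‖ ^ 2 ≤ gM k + (gp k + gn k) := by
    intro k
    by_cases hk : k = 0
    · subst hk
      have h0 : (D.stateCoeff ν M + (Pi.single (0 : Fin 3 → ℤ) (complexify M) :
          (Fin 3 → ℤ) → ℂ³)) 0 = complexify M := by
        rw [Pi.add_apply, stateCoeff_zero, zero_add, Pi.single_eq_same]
      have h1 : gM 0 = ‖complexify M‖ ^ 2 := by rw [hgM]; simp
      have h2 : 0 ≤ gp 0 := by rw [hgp]; positivity
      have h3 : 0 ≤ gn 0 := by rw [hgn]; positivity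
      rw [h0, h1]
      linarith
    · have h1 : (D.stateCoeff ν M + (Pi.single (0 : Fin 3 → ℤ) (complexify M) :
          (Fin 3 → ℤ) → ℂ³)) k = D.stateCoeff ν M k := by
        rw [Pi.add_apply, Pi.single_eq_of_ne hk, add_zero]
      have h2 : 0 ≤ gM k := by rw [hgM]; positivity
      have h3 := D.norm_sq_stateCoeff_le ν hres k
      have h4 : gp k + gn k = D.ext k ^ 2 / (2 * Real.pi * kdot k M) ^ 2 +
          D.ext (-k) ^ 2 / (2 * Real.pi * kdot k M) ^ 2 := by rw [hgp, hgn]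
      rw [h1]
      linarith
  -- sums of the majorants
  have hM : ∑ k ∈ T, gM k ≤ ‖M‖ ^ 2 := by
    have heq : gM = (Pi.single (0 : Fin 3 → ℤ) (‖M‖ ^ 2) : (Fin 3 → ℤ) → ℝ) := by
      funext k
      by_cases hk : k = 0
      · subst hk; simp [hgM]
      · simp [hgM, Pi.single_eq_of_ne hk]
    rw [heq, Finset.sum_pi_single']
    split_ifs
    · exact le_rfl
    · positivity
  have hp : ∑ k ∈ T, gp k ≤ ∑' n, D.energyMajorant M n := by
    have heq : gp = extend D.K (D.energyMajorant M) 0 := by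
      rw [hgp]
      funext k
      by_cases h : ∃ n, D.K n = k
      · obtain ⟨n, rfl⟩ := h
        rw [D.K_injective.extend_apply, ext_K, energyMajorant]
      · rw [extend_apply' _ _ _ h, D.ext_of_not h, Pi.zero_apply]; simp
    have hs : Summable gp := by rw [heq, summable_extend_zero D.K_injective]; exact hA
    calc ∑ k ∈ T, gp k ≤ ∑' k, gp k :=
          hs.sum_le_tsum T fun k _ => by rw [hgp]; dsimp only; positivity
      _ = ∑' n, D.energyMajorant M n := by rw [heq, tsum_extend_zero D.K_injective]
  have hn : ∑ k ∈ T, gn k ≤ ∑' n, D.energyMajorant M n := by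
    have heq : gn = extend D.negK (D.energyMajorant M) 0 := by
      rw [hgn]
      funext k
      by_cases h : ∃ n, D.negK n = k
      · obtain ⟨n, rfl⟩ := h
        rw [D.negK_injective.extend_apply, negK_apply, neg_neg, ext_K, kdot_neg_left,
          energyMajorant]
        ring
      · have h' : ¬∃ n, D.K n = -k := fun ⟨n, hn⟩ => h ⟨n, by rw [negK_apply, hn, neg_neg]⟩
        rw [extend_apply' _ _ _ h, D.ext_of_not h', Pi.zero_apply]; simp
    have hs : Summable gn := by rw [heq, summable_extend_zero D.negK_injective]; exact hA
    calc ∑ k ∈ T, gn k ≤ ∑' k, gn k :=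
          hs.sum_le_tsum T fun k _ => by rw [hgn]; dsimp only; positivity
      _ = ∑' n, D.energyMajorant M n := by rw [heq, tsum_extend_zero D.negK_injective]
  calc ∑ k ∈ T, ‖(D.stateCoeff ν M + (Pi.single (0 : Fin 3 → ℤ) (complexify M) :
        (Fin 3 → ℤ) → ℂ³)) k‖ ^ 2
      ≤ ∑ k ∈ T, (gM k + (gp k + gn k)) := Finset.sum_le_sum fun k _ => hpt k
    _ = ∑ k ∈ T, gM k + (∑ k ∈ T, gp k + ∑ k ∈ T, gn k) := by
        rw [Finset.sum_add_distrib, Finset.sum_add_distrib]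
    _ ≤ ‖M‖ ^ 2 + 2 * ∑' n, D.energyMajorant M n := by linarith

/-- **Enstrophy of the laminar state from below**: if `𝓕 u = b + δ₀ M` then for every `N`,
`4π² ∑_{n<N} |Kₙ|² aₙ² / |σ_ν(Kₙ)|² ≤ ‖∇u‖₂²`. [folklore] -/
theorem dissipation_ge_of_coeff {ν : ℝ} {M : E³} {u : 𝕋³ → E³} (hu : IsSmooth u)
    (hû : mFourierCoeff (complexify ∘ u) =
      D.stateCoeff ν M + (Pi.single (0 : Fin 3 → ℤ) (complexify M) : (Fin 3 → ℤ) → ℂ³))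
    (N : ℕ) :
    4 * Real.pi ^ 2 * ∑ n ∈ Finset.range N,
        freqNormSq (D.K n) * (D.a n ^ 2 / ‖shearSymbol ν M (D.K n)‖ ^ 2) ≤
      (eGradNormSq u).toReal := by
  set S : ℝ := ∑ n ∈ Finset.range N,
    freqNormSq (D.K n) * (D.a n ^ 2 / ‖shearSymbol ν M (D.K n)‖ ^ 2) with hS
  have hS0 : 0 ≤ S := Finset.sum_nonneg fun n _ => mul_nonneg (freqNormSq_nonneg _) (by positivity)
  -- the per-mode terms on the Fourier side
  have hterm : ∀ n, (if D.K n = 0 then 0 else ENNReal.ofReal (freqNormSq (D.K n) ^ (1 : ℝ))) *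
      ‖mFourierCoeff (complexify ∘ u) (D.K n)‖ₑ ^ 2 =
        ENNReal.ofReal (freqNormSq (D.K n) * (D.a n ^ 2 / ‖shearSymbol ν M (D.K n)‖ ^ 2)) := by
    intro n
    rw [if_neg (D.K_ne_zero n), Real.rpow_one, hû, Pi.add_apply, Pi.single_eq_of_ne (D.K_ne_zero n),
      add_zero, ← ofReal_norm, ← ENNReal.ofReal_pow (norm_nonneg _), norm_stateCoeff,
      amp_K, div_pow, sq_abs, ← ENNReal.ofReal_mul (freqNormSq_nonneg _)]
  have hle : ENNReal.ofReal (4 * Real.pi ^ 2) * ENNReal.ofReal S ≤ eGradNormSq u := by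
    rw [eGradNormSq, eHomSobolevSeminorm, ENNReal.rpow_half_sq]
    gcongr
    rw [hS, ENNReal.ofReal_sum_of_nonneg fun n _ => mul_nonneg (freqNormSq_nonneg _) (by positivity)]
    calc ∑ n ∈ Finset.range N, ENNReal.ofReal
          (freqNormSq (D.K n) * (D.a n ^ 2 / ‖shearSymbol ν M (D.K n)‖ ^ 2))
        = ∑ n ∈ Finset.range N, (if D.K n = 0 then 0 else
            ENNReal.ofReal (freqNormSq (D.K n) ^ (1 : ℝ))) *
              ‖mFourierCoeff (complexify ∘ u) (D.K n)‖ₑ ^ 2 :=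
          Finset.sum_congr rfl fun n _ => (hterm n).symm
      _ = ∑ k ∈ (Finset.range N).image D.K, (if k = 0 then 0 else
            ENNReal.ofReal (freqNormSq k ^ (1 : ℝ))) * ‖mFourierCoeff (complexify ∘ u) k‖ₑ ^ 2 :=
          by rw [Finset.sum_image fun n _ m _ h => D.K_injective h]
      _ ≤ _ := ENNReal.sum_le_tsum _
  have h := ENNReal.toReal_mono (eGradNormSq_lt_top hu).ne hle
  rwa [← ENNReal.ofReal_mul (by positivity), ENNReal.toReal_ofReal (mul_nonneg (by positivity) hS0)] at h

/-! ### Leray–Hopf packaging -/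

/-- **The laminar shear family along any viscosity sequence.** For a shear design with no
resonant mode (`Kₙ·M ≠ 0`) and summable energy majorant, and any positive viscosities `νⱼ`, the
laminar states `uⱼ` are global Leray–Hopf solutions of `NS_{νⱼ}(f)` for the FIXED force `f` of the
design, with mean energy `≤ ‖M‖² + 2∑ₙ aₙ²/(2π Kₙ·M)²` uniformly in `j`, mean dissipation
`νⱼ‖∇uⱼ‖₂²` bounded below through `dissipation_ge_of_coeff`, Fourier coefficients
`σ_{νⱼ}⁻¹ F + δ₀ M`, and mean mode (momentum) `M`. [folklore] -/
theorem exists_shearFamily {M : E³} (hres : ∀ n, kdot (D.K n) M ≠ 0)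
    (hA : Summable (D.energyMajorant M)) (ν : ℕ → ℝ) (hν : ∀ j, 0 < ν j) :
    ∃ u : ℕ → 𝕋³ → E³,
      (∀ j, Torus.IsGlobalLerayHopf (ν j) (fun _ => D.force) (u j) (fun _ => u j)) ∧
      (∀ j, IsSmooth (u j)) ∧
      (∀ j, meanEnergy (fun _ : ℝ => u j) ≤ ‖M‖ ^ 2 + 2 * ∑' n, D.energyMajorant M n) ∧
      (∀ j, meanDissipation (ν j) (fun _ : ℝ => u j) = ν j * (eGradNormSq (u j)).toReal) ∧
      (∀ j N, 4 * Real.pi ^ 2 * ∑ n ∈ Finset.range N,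
          freqNormSq (D.K n) * (D.a n ^ 2 / ‖shearSymbol (ν j) M (D.K n)‖ ^ 2) ≤
        (eGradNormSq (u j)).toReal) ∧
      (∀ j, mFourierCoeff (complexify ∘ u j) =
        D.stateCoeff (ν j) M + (Pi.single (0 : Fin 3 → ℤ) (complexify M) : (Fin 3 → ℤ) → ℂ³)) ∧
      (∀ j, mFourierCoeff (complexify ∘ u j) 0 = complexify M) := by
  choose u p hst hsm hco using fun j => D.exists_shearState (hν j) M
  refine ⟨u, fun j => IsClassicalNSSolutionOn.isGlobalLerayHopf (hst j), hsm, fun j => ?_,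
    fun j => ?_, fun j N => D.dissipation_ge_of_coeff (hsm j) (hco j) N, hco, fun j => ?_⟩
  · rw [meanEnergy_eq_longTimeAvgSup, longTimeAvgSup_of_eq_const fun _ _ => rfl]
    exact D.integral_norm_sq_le_of_coeff hres hA (hsm j) (hco j)
  · unfold meanDissipation
    exact longTimeAvgSup_of_eq_const fun _ _ => rfl
  · rw [hco j, Pi.add_apply, stateCoeff_zero, zero_add, Pi.single_eq_same]

end ShearDesign

end Summit.AnomalousDissipation.AnomalousDissipation.Theorems

end
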